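import Mathlib
import Summits.AtomisticToContinuum.Crystallization.Theses.NashClassCertificates
import Literature.MathematicalPhysics.StatisticalMechanics.CrystallizationSymmetries
import Summits.AtomisticToContinuum.Crystallization.Theorems.PhononSlackCertificatesNearFieldConvexityStubFluxEnvelope
import Summits.AtomisticToContinuum.Crystallization.Theorems.PhononSlackCertificatesNearFieldConvexityStubSelfSiteFloor
import Summits.AtomisticToContinuum.Crystallization.Theorems.PhononSlackCertificatesNearFieldConvexityStubPnfOfLocalCertificate
import Summits.AtomisticToContinuum.Crystallization.Theorems.PhononSlackCertificatesNearFieldConvexityStubCruxOfPureNearField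
import Summits.AtomisticToContinuum.Crystallization.Theorems.ReggeStarCoercivityDefectFreeCrystallizesSqueezeToLayeredA
import Summits.AtomisticToContinuum.Crystallization.Theorems.PhononSlackCertificatesAllBadGapFloor

/-!
# Crux `NashNearField` (stmt-AtomisticToContinuum-16827), line `birth` (skeleton v10): the ENERGY-SPLIT COMPOSITION on the Nash class,
# part I — summed interior coercivity from C′ + I_flat + II_band (`es_interiorCoercivity_of_split`, = the skeleton's `interiorCoercivity_of_v10`)

Hypotheses (all inlined): C′ (the landed `stub_offFamilyOfNonLayered`); I_flat on the Nash class (registered stub `stub_nashFlatnessPaid`: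
`Σ_int₈(2400ν² + 800r²) ≤ K·[E_self − |Ω|e*] + C·#∂₄Ω` on `ε₁`-good clusters); II_band on the Nash class (registered stub `stub_nashRoughSitesPaid`:
`#{¬ε₁-good} ≤ K·[E_self − |Ω|e*] + C·#∂₄Ω`); radius-3 charts of good sets (`chart_of_stubs_radius`).  Conclusion: the summed interior coercivity
`c·#{i ∈ int₈Ω : B(x i,2) not η-layered} ≤ [E_self(Ω) − |Ω|e*] + C·#∂₄Ω` on good clusters of `1/3`-separated Nash force-balanced configurations.
Proof: `η' = min η (1/10)`; excise the non-`ε₁`-good particles (II_band; radius-8 neighbourhoods by the packing count `(6ρ+1)³`, sub-cluster excess by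
the flux envelope + periodisation floor); on the `ε₁`-good sub-cluster a non-`η'`-layered radius-8 interior site has `ν > η'/2` or `r > η'/2` (else C′
puts `G` `(η' − ν ≥ η'/2)`-far from its own `r`-close cell); Chebyshev `200η'²·#bad ≤ Σ(2400ν² + 800r²)`.  No smallness condition.  `[folklore]`.
-/


noncomputable section
open scoped BigOperators
open Literature.MathematicalPhysics.StatisticalMechanics Literature.Geometry.DiscreteGeometry

namespace Summit.AtomisticToContinuum.Crystallization.Theorems.NashClassCertificatesNashNearField

open Summit.AtomisticToContinuum.Crystallization.Theorems.PhononSlackNearFieldConvexity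

/-- Ball count under `1/3`-separation: at most `(6ρ+1)³` particles within `ρ` of a particle. -/
theorem es_card_filter_dist_le {N : ℕ} (x : Fin N → EuclideanSpace ℝ (Fin 3))
    (hsep : ∀ i j : Fin N, i ≠ j → 1 / 3 ≤ dist (x i) (x j)) (Ω : Finset (Fin N)) (i₀ : Fin N)
    {ρ : ℝ} (hρ : 0 ≤ ρ) :
    ((Ω.filter fun i : Fin N => dist (x i) (x i₀) ≤ ρ).card : ℝ) ≤ (6 * ρ + 1) ^ 3 := by
  classical
  have h := Summit.AtomisticToContinuum.Crystallization.Theorems.PrestressSplitKorn.squeeze_card_filter_dist_le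
    (by norm_num : (0 : ℝ) < 1 / 3) hρ hsep i₀
  have hsub : (Ω.filter fun i : Fin N => dist (x i) (x i₀) ≤ ρ) ⊆
      Finset.univ.filter fun i : Fin N => dist (x i₀) (x i) ≤ ρ := by
    intro i hi
    rw [Finset.mem_filter] at hi ⊢
    exact ⟨Finset.mem_univ _, by rw [dist_comm]; exact hi.2⟩
  have h1 : ((Ω.filter fun i : Fin N => dist (x i) (x i₀) ≤ ρ).card : ℝ) ≤
      ((Finset.univ.filter fun i : Fin N => dist (x i₀) (x i) ≤ ρ).card : ℝ) := by
    exact_mod_cast Finset.card_le_card hsub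
  have h2 : (2 * ρ / (1 / 3) + 1) ^ 3 = (6 * ρ + 1) ^ 3 := by ring
  linarith [h2 ▸ h]

/-- Neighbourhood count: the particles of `Ω` within `ρ` of SOME particle of `R` number at most `(6ρ+1)³·#R`. -/
theorem es_card_filter_near_le {N : ℕ} (x : Fin N → EuclideanSpace ℝ (Fin 3))
    (hsep : ∀ i j : Fin N, i ≠ j → 1 / 3 ≤ dist (x i) (x j)) (Ω R : Finset (Fin N)) {ρ : ℝ} (hρ : 0 ≤ ρ) :
    ((Ω.filter fun i : Fin N => ∃ k ∈ R, dist (x i) (x k) ≤ ρ).card : ℝ) ≤ (6 * ρ + 1) ^ 3 * (R.card : ℝ) := by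
  classical
  have hsub : (Ω.filter fun i : Fin N => ∃ k ∈ R, dist (x i) (x k) ≤ ρ) ⊆
      R.biUnion fun k => Ω.filter fun i : Fin N => dist (x i) (x k) ≤ ρ := by
    intro i hi
    rw [Finset.mem_filter] at hi
    obtain ⟨k, hk, hd⟩ := hi.2
    rw [Finset.mem_biUnion]
    exact ⟨k, hk, Finset.mem_filter.2 ⟨hi.1, hd⟩⟩
  have h1 : ((Ω.filter fun i : Fin N => ∃ k ∈ R, dist (x i) (x k) ≤ ρ).card : ℝ) ≤
      ((R.biUnion fun k => Ω.filter fun i : Fin N => dist (x i) (x k) ≤ ρ).card : ℝ) := by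
    exact_mod_cast Finset.card_le_card hsub
  have h2 : ((R.biUnion fun k => Ω.filter fun i : Fin N => dist (x i) (x k) ≤ ρ).card : ℝ) ≤
      ∑ k ∈ R, ((Ω.filter fun i : Fin N => dist (x i) (x k) ≤ ρ).card : ℝ) := by
    exact_mod_cast Finset.card_biUnion_le
  have h3 : ∑ k ∈ R, ((Ω.filter fun i : Fin N => dist (x i) (x k) ≤ ρ).card : ℝ) ≤ ∑ _k ∈ R, (6 * ρ + 1) ^ 3 :=
    Finset.sum_le_sum fun k _ => es_card_filter_dist_le x hsep Ω k hρ
  rw [Finset.sum_const, nsmul_eq_mul] at h3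
  linarith

/-- **Sub-cluster excess.**  Removing a set of particles from a `1/3`-separated cluster raises the bulk excess
`E(x|_Ω) − |Ω|·e*` by at most `(250·3⁶/6)` per removed particle: the removed part has `E ≥ |·| e*`
(periodisation floor) and the cross interaction is `≥ −Σ r⁻⁶/6 ≥ −(250·3⁶/6)·#removed` (flux envelope). -/
theorem es_subcluster_excess_le {N : ℕ} (x : Fin N → EuclideanSpace ℝ (Fin 3))
    (hsep : ∀ i j : Fin N, i ≠ j → 1 / 3 ≤ dist (x i) (x j)) (Ω : Finset (Fin N))
    (p : Fin N → Prop) [DecidablePred p] :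
    (∑ i ∈ Ω.filter p, (1 / 2 : ℝ) * (∑ j ∈ (Ω.filter p).erase i, lennardJones (dist (x i) (x j)))) -
        ((Ω.filter p).card : ℝ) * (⨅ Q : PeriodicConfiguration 3, Q.energyPerParticle lennardJones) ≤
      (∑ i ∈ Ω, (1 / 2 : ℝ) * (∑ j ∈ Ω.erase i, lennardJones (dist (x i) (x j)))) -
        (Ω.card : ℝ) * (⨅ Q : PeriodicConfiguration 3, Q.energyPerParticle lennardJones) +
      250 * (1 / 3 : ℝ)⁻¹ ^ 6 / 6 * ((Ω.filter fun i => ¬ p i).card : ℝ) := by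
  classical
  set A := Ω.filter p with hA
  set B := Ω.filter fun i => ¬ p i with hB
  have hδ : (0 : ℝ) < 1 / 3 := by norm_num
  have hAB : Disjoint A B := Finset.disjoint_filter_filter_not Ω Ω p
  have hBA : Disjoint B A := hAB.symm
  -- split the outer sum
  have hsplit : (∑ i ∈ Ω, (1 / 2 : ℝ) * (∑ j ∈ Ω.erase i, lennardJones (dist (x i) (x j)))) =
      (∑ i ∈ A, (1 / 2 : ℝ) * (∑ j ∈ Ω.erase i, lennardJones (dist (x i) (x j)))) +
        ∑ i ∈ B, (1 / 2 : ℝ) * (∑ j ∈ Ω.erase i, lennardJones (dist (x i) (x j))) :=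
    (Finset.sum_filter_add_sum_filter_not Ω p _).symm
  -- inner sums: for `i ∈ A`, `Ω.erase i = A.erase i ∪ B`; for `i ∈ B`, `Ω.erase i = B.erase i ∪ A`
  have heraseA : ∀ i ∈ A, Ω.erase i = A.erase i ∪ B := by
    intro i hi
    have hpi : p i := (Finset.mem_filter.1 hi).2
    ext j
    simp only [hA, hB, Finset.mem_erase, Finset.mem_union, Finset.mem_filter]
    constructor
    · rintro ⟨hji, hj⟩
      by_cases hpj : p j
      · exact Or.inl ⟨hji, hj, hpj⟩
      · exact Or.inr ⟨hj, hpj⟩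
    · rintro (⟨hji, hj, -⟩ | ⟨hj, hpj⟩)
      · exact ⟨hji, hj⟩
      · exact ⟨fun h => hpj (h ▸ hpi), hj⟩
  have heraseB : ∀ i ∈ B, Ω.erase i = B.erase i ∪ A := by
    intro i hi
    have hpi : ¬ p i := (Finset.mem_filter.1 hi).2
    ext j
    simp only [hA, hB, Finset.mem_erase, Finset.mem_union, Finset.mem_filter]
    constructor
    · rintro ⟨hji, hj⟩
      by_cases hpj : p j
      · exact Or.inr ⟨hj, hpj⟩
      · exact Or.inl ⟨hji, hj, hpj⟩
    · rintro (⟨hji, hj, -⟩ | ⟨hj, hpj⟩)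
      · exact ⟨hji, hj⟩
      · exact ⟨fun h => hpi (h ▸ hpj), hj⟩
  have hsumA : (∑ i ∈ A, (1 / 2 : ℝ) * (∑ j ∈ Ω.erase i, lennardJones (dist (x i) (x j)))) =
      (∑ i ∈ A, (1 / 2 : ℝ) * (∑ j ∈ A.erase i, lennardJones (dist (x i) (x j)))) +
        (1 / 2 : ℝ) * ∑ i ∈ A, ∑ j ∈ B, lennardJones (dist (x i) (x j)) := by
    rw [Finset.mul_sum, ← Finset.sum_add_distrib]
    refine Finset.sum_congr rfl fun i hi => ?_
    rw [heraseA i hi, Finset.sum_union ((Finset.disjoint_of_subset_left (Finset.erase_subset _ _)) hAB)]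
    ring
  have hsumB : (∑ i ∈ B, (1 / 2 : ℝ) * (∑ j ∈ Ω.erase i, lennardJones (dist (x i) (x j)))) =
      (∑ i ∈ B, (1 / 2 : ℝ) * (∑ j ∈ B.erase i, lennardJones (dist (x i) (x j)))) +
        (1 / 2 : ℝ) * ∑ i ∈ B, ∑ j ∈ A, lennardJones (dist (x i) (x j)) := by
    rw [Finset.mul_sum, ← Finset.sum_add_distrib]
    refine Finset.sum_congr rfl fun i hi => ?_
    rw [heraseB i hi, Finset.sum_union ((Finset.disjoint_of_subset_left (Finset.erase_subset _ _)) hBA)]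
    ring
  -- the cross terms are `≥ −(1/6)·Σ r⁻⁶ ≥ −(250·3⁶/6)·#B`
  have hcross1 : -(250 * (1 / 3 : ℝ)⁻¹ ^ 6 / 6 * (B.card : ℝ)) ≤ ∑ i ∈ A, ∑ j ∈ B, lennardJones (dist (x i) (x j)) := by
    have h1 : ∑ i ∈ A, ∑ j ∈ B, -(1 / 6 * (dist (x i) (x j))⁻¹ ^ 6) ≤ ∑ i ∈ A, ∑ j ∈ B, lennardJones (dist (x i) (x j)) :=
      Finset.sum_le_sum fun i _ => Finset.sum_le_sum fun j _ => Summit.AtomisticToContinuum.Crystallization.Theorems.PhononSlackCertificatesAllBadGapFloor.neg_inv_pow_six_le_lennardJones _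
    have h2 : ∑ i ∈ A, ∑ j ∈ B, -(1 / 6 * (dist (x i) (x j))⁻¹ ^ 6) =
        -(1 / 6) * ∑ i ∈ A, ∑ j ∈ B, (dist (x i) (x j))⁻¹ ^ 6 := by
      rw [Finset.mul_sum]
      refine Finset.sum_congr rfl fun i _ => ?_
      rw [Finset.mul_sum]
      refine Finset.sum_congr rfl fun j _ => by ring
    have h3 := stub_fluxEnvelope N x (1 / 3) hδ hsep A B hAB
    rw [h2] at h1
    nlinarith
  have hcross2 : -(250 * (1 / 3 : ℝ)⁻¹ ^ 6 / 6 * (B.card : ℝ)) ≤ ∑ i ∈ B, ∑ j ∈ A, lennardJones (dist (x i) (x j)) := by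
    rw [Finset.sum_comm]
    have heq : ∑ j ∈ A, ∑ i ∈ B, lennardJones (dist (x i) (x j)) = ∑ i ∈ A, ∑ j ∈ B, lennardJones (dist (x i) (x j)) :=
      Finset.sum_congr rfl fun i _ => Finset.sum_congr rfl fun j _ => by rw [dist_comm]
    rw [heq]
    exact hcross1
  -- the removed part is floored by periodisation
  have hBfloor := pureNearField_self_floor x hδ hsep B
  have hcard : (A.card : ℝ) + (B.card : ℝ) = (Ω.card : ℝ) := by
    exact_mod_cast Finset.card_filter_add_card_filter_not p
  rw [hsplit, hsumA, hsumB]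
  set E := (⨅ Q : PeriodicConfiguration 3, Q.energyPerParticle lennardJones) with hE
  have hce : (Ω.card : ℝ) * E = (A.card : ℝ) * E + (B.card : ℝ) * E := by rw [← hcard]; ring
  linarith [hcross1, hcross2, hBfloor, hce]

/-- Layeredness is monotone in the tolerance (inline predicate of the crux). -/
theorem es_layered_mono {N : ℕ} (x : Fin N → EuclideanSpace ℝ (Fin 3)) (i : Fin N) {η η' : ℝ} (hle : η' ≤ η)
    (h : (∃ (A : EuclideanSpace ℝ (Fin 3) →ₗᵢ[ℝ] EuclideanSpace ℝ (Fin 3)) (t : EuclideanSpace ℝ (Fin 3)) (a : ℝ) (s : ℤ → ℤ) (z : ℤ → ℝ), 47 / 50 ≤ a ∧ a ≤ 1 ∧ IsHaggSeq s ∧ (∀ m : ℤ, 39 / 50 * a ≤ z (m + 1) - z m ∧ z (m + 1) - z m ≤ 17 / 20 * a) ∧ (fun S : Set (EuclideanSpace ℝ (Fin 3)) => (∀ j : Fin N, dist (x j) (x i) ≤ 2 → ∃ p ∈ S, dist (x j + t) p ≤ η') ∧ (∀ p ∈ S, dist p (x i + t) ≤ 2 → ∃ j : Fin N, dist (x j +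 t) p ≤ η')) {p | ∃ m i j : ℤ, p = A (((i : ℝ) • triangularVec₁ a) + ((j : ℝ) • triangularVec₂ a) + ((haggLabel s m : ℝ) • barlowOffset a) + (z m • layerNormal 1))})) : (∃ (A : EuclideanSpace ℝ (Fin 3) →ₗᵢ[ℝ] EuclideanSpace ℝ (Fin 3)) (t : EuclideanSpace ℝ (Fin 3)) (a : ℝ) (s : ℤ → ℤ) (z : ℤ → ℝ), 47 / 50 ≤ a ∧ a ≤ 1 ∧ IsHaggSeq s ∧ (∀ m : ℤ, 39 / 50 * a ≤ z (m + 1) - z m ∧ z (m + 1) - z m ≤ 17 / 20 * a) ∧ (fun S : Set (EuclideanSpace ℝ (Fin 3)) => (∀ j : Fin N, dist (x j) (x i) ≤ 2 → ∃ p ∈ S, dist (x j + t) p ≤ η) ∧ (∀ p ∈ S, dist p (x i + t) ≤ 2 → ∃ j : Fin N, dist (x j + t) p ≤ η)) {p | ∃ m i j : ℤ, p = A (((i : ℝ) • triangularVec₁ a) + ((j : ℝ) • triangularVec₂ a) + ((haggLabel s m : ℝ) • barlowOffset a) + (z m • layerNormal 1))}) := by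
  obtain ⟨A, t, a, s, z, ha₁, ha₂, hs, hz, h₁, h₂⟩ := h
  refine ⟨A, t, a, s, z, ha₁, ha₂, hs, hz, fun j hj => ?_, fun p hp hd => ?_⟩
  · obtain ⟨p, hp, hd⟩ := h₁ j hj
    exact ⟨p, hp, hd.trans hle⟩
  · obtain ⟨j, hj⟩ := h₂ p hp hd
    exact ⟨j, hj.trans hle⟩

/-- **C′ + I_flat + II_band (+ radius-3 charts) ⟹ summed interior coercivity on the Nash class** (constants: `c = 200η'²/(K + L·K₂ + 1)`,
`C = (L|C_II| + |C_I|)/(K + L·K₂ + 1)`, `L = K·K₁ + |C_I|K₄ + 200η'²(1+K₈)`). [folklore] -/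
theorem es_interiorCoercivity_of_split (hC : (∀ (N : ℕ) (x : Fin N → EuclideanSpace ℝ (Fin 3)) (i : Fin N) (s : ℤ → ℤ) (G : EuclideanSpace ℝ (Fin 3) →L[ℝ] EuclideanSpace ℝ (Fin 3)) (ν η : ℝ),
      IsHaggSeq s → 0 ≤ ν → ν ≤ η / 2 → η ≤ 1 / 10 →
      ((∀ j : Fin N, dist (x j) (x i) ≤ 3 → ∃ m u v : ℤ, dist (x j - x i) (G (barlowPos 1 (Real.sqrt 6 / 3) s m u v)) ≤ ν) ∧ (∀ m u v : ℤ, ‖G (barlowPos 1 (Real.sqrt 6 / 3) s m u v)‖ ≤ 3 → ∃ j : Fin N, dist (x j - x i) (G (barlowPos 1 (Real.sqrt 6 / 3) s m u v)) ≤ ν) ∧ (∀ p : EuclideanSpace ℝ (Fin 3), 4 / 5 * ‖p‖ ≤ ‖G p‖ ∧ ‖G p‖ ≤ 6 / 5 * ‖p‖)) →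
      ¬ (∃ (A : EuclideanSpace ℝ (Fin 3) →ₗᵢ[ℝ] EuclideanSpace ℝ (Fin 3)) (t : EuclideanSpace ℝ (Fin 3)) (a : ℝ) (s : ℤ → ℤ) (z : ℤ → ℝ), 47 / 50 ≤ a ∧ a ≤ 1 ∧ IsHaggSeq s ∧ (∀ m : ℤ, 39 / 50 * a ≤ z (m + 1) - z m ∧ z (m + 1) - z m ≤ 17 / 20 * a) ∧ (fun S : Set (EuclideanSpace ℝ (Fin 3)) => (∀ j : Fin N, dist (x j) (x i) ≤ 2 → ∃ p ∈ S, dist (x j + t) p ≤ η) ∧ (∀ p ∈ S, dist p (x i + t) ≤ 2 → ∃ j : Fin N, dist (x j + t) p ≤ η)) {p | ∃ m i j : ℤ, p = A (((i : ℝ) • triangularVec₁ a) + ((j : ℝ) • triangularVec₂ a) + ((haggLabel s m : ℝ) • barlowOffset a) + (z m • layerNormal 1))}) →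
      (∀ (A : EuclideanSpace ℝ (Fin 3) →ₗᵢ[ℝ] EuclideanSpace ℝ (Fin 3)) (a h : ℝ), 47 / 50 ≤ a → a ≤ 1 → 39 / 50 * a ≤ h → h ≤ 17 / 20 * a → ∃ m u v : ℤ, ‖barlowPos 1 (Real.sqrt 6 / 3) s m u v‖ ≤ 3 ∧ (η - ν) ≤ dist (G (barlowPos 1 (Real.sqrt 6 / 3) s m u v)) (A (barlowPos a h s m u v)))))
    (hI : (∃ ε₁ : ℝ, 1 / 100 ≤ ε₁ ∧ ε₁ ≤ 1 / 20 ∧ ∃ K : ℝ, 0 ≤ K ∧ ∃ C : ℝ, ∀ (N : ℕ) (x : Fin N → EuclideanSpace ℝ (Fin 3)),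
      (∀ i j : Fin N, i ≠ j → 1 / 3 ≤ dist (x i) (x j)) →
      (∀ (i : Fin N) (y : EuclideanSpace ℝ (Fin 3)), (∀ j : Fin N, j ≠ i → y ≠ x j) → siteEnergy lennardJones x i ≤ ∑ j ∈ Finset.univ.erase i, lennardJones (dist y (x j))) →
      (∀ i : Fin N, ∑ j ∈ Finset.univ.erase i, (deriv lennardJones (dist (x i) (x j)) / dist (x i) (x j)) • (x i - x j) = 0) →
      ∀ Ω : Finset (Fin N), (∀ i ∈ Ω, IsTwoShellGood ε₁ (47 / 50) 1 x i) →
      ∃ (sW : Fin N → ℤ → ℤ) (Gw : Fin N → (EuclideanSpace ℝ (Fin 3) →L[ℝ] EuclideanSpace ℝ (Fin 3))) (νw rw : Fin N → ℝ) (Aw : Fin N → (EuclideanSpace ℝ (Fin 3) →ₗᵢ[ℝ] EuclideanSpace ℝ (Fin 3))) (aw hw : Fin N → ℝ), (∀ i ∈ Ω, (∀ k : Fin N, dist (x k) (x i) ≤ 8 → k ∈ Ω) → IsHaggSeq (sW i) ∧ 0 ≤ νw i ∧ ((∀ j : Fin N, dist (x j) (x i) ≤ 3 → ∃ m u v : ℤ,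 dist (x j - x i) ((Gw i) (barlowPos 1 (Real.sqrt 6 / 3) (sW i) m u v)) ≤ (νw i)) ∧ (∀ m u v : ℤ, ‖(Gw i) (barlowPos 1 (Real.sqrt 6 / 3) (sW i) m u v)‖ ≤ 3 → ∃ j : Fin N, dist (x j - x i) ((Gw i) (barlowPos 1 (Real.sqrt 6 / 3) (sW i) m u v)) ≤ (νw i)) ∧ (∀ p : EuclideanSpace ℝ (Fin 3), 4 / 5 * ‖p‖ ≤ ‖(Gw i) p‖ ∧ ‖(Gw i) p‖ ≤ 6 / 5 * ‖p‖)) ∧ 47 / 50 ≤ aw i ∧ aw i ≤ 1 ∧ 39 / 50 * aw i ≤ hw i ∧ hw i ≤ 17 / 20 * aw i ∧ (∀ m u v : ℤ, ‖barlowPos 1 (Real.sqrt 6 / 3) (sW i) m u v‖ ≤ 3 → dist ((Gw i) (barlowPos 1 (Real.sqrt 6 / 3) (sW i) m u v)) ((Aw i) (barlowPos (aw i) (hw i) (sW i) m u v)) < rw i)) ∧ (∑ i ∈ Ω.filter (fun i => ∀ k : Fin N, dist (x k) (x i) ≤ 8 → k ∈ Ω), (2400 * (νw i) ^ 2 + 800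 * (rw i) ^ 2)) ≤ K * ((∑ i ∈ Ω, (1 / 2 : ℝ) * (∑ j ∈ Ω.erase i, lennardJones (dist (x i) (x j)))) - (Ω.card : ℝ) * (⨅ Q : PeriodicConfiguration 3, Q.energyPerParticle lennardJones)) + C * (Nat.card {i : Fin N // i ∈ Ω ∧ ∃ j : Fin N, j ∉ Ω ∧ dist (x j) (x i) ≤ 4} : ℝ)))
    (hII : (∀ ε₁ : ℝ, 1 / 100 ≤ ε₁ → ε₁ ≤ 1 / 20 → ∃ K : ℝ, 0 ≤ K ∧ ∃ C : ℝ, ∀ (N : ℕ) (x : Fin N → EuclideanSpace ℝ (Fin 3)),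
      (∀ i j : Fin N, i ≠ j → 1 / 3 ≤ dist (x i) (x j)) →
      (∀ (i : Fin N) (y : EuclideanSpace ℝ (Fin 3)), (∀ j : Fin N, j ≠ i → y ≠ x j) → siteEnergy lennardJones x i ≤ ∑ j ∈ Finset.univ.erase i, lennardJones (dist y (x j))) →
      (∀ i : Fin N, ∑ j ∈ Finset.univ.erase i, (deriv lennardJones (dist (x i) (x j)) / dist (x i) (x j)) • (x i - x j) = 0) →
      ∀ Ω : Finset (Fin N), (∀ i ∈ Ω, IsTwoShellGood (1 / 20) (47 / 50) 1 x i) →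
      (∀ i ∈ Ω, (∀ k : Fin N, dist (x k) (x i) ≤ 3 → k ∈ Ω) → (∃ (A : EuclideanSpace ℝ (Fin 3) →ₗᵢ[ℝ] EuclideanSpace ℝ (Fin 3)) (a h : ℝ) (s : ℤ → ℤ), 47 / 50 ≤ a ∧ a ≤ 1 ∧ 39 / 50 * a ≤ h ∧ h ≤ 17 / 20 * a ∧ IsHaggSeq s ∧ (fun S : Set (EuclideanSpace ℝ (Fin 3)) => (∀ j : Fin N, dist (x j) (x i) ≤ 2 → ∃ p ∈ S, dist (x j) p ≤ 2 / 5) ∧ (∀ p ∈ S, dist p (x i) ≤ 2 → ∃ j : Fin N, dist (x j) p ≤ 2 / 5)) {p | ∃ m u v : ℤ, p = x i + A (((u : ℝ) • triangularVec₁ a) + ((v : ℝ) • triangularVec₂ a) + ((haggLabel s m : ℝ) • barlowOffset a) + ((m : ℝ) • layerNormal h))})) → (Nat.card {i : Fin N // i ∈ Ω ∧ ¬ IsTwoShellGood ε₁ (47 / 50) 1 x i} : ℝ) ≤ K * ((∑ i ∈ Ω, (1 / 2 : ℝ) * (∑ j ∈ Ω.erase i, lennardJones (dist (x i) (x j))))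 - (Ω.card : ℝ) * (⨅ Q : PeriodicConfiguration 3, Q.energyPerParticle lennardJones)) + C * (Nat.card {i : Fin N // i ∈ Ω ∧ ∃ j : Fin N, j ∉ Ω ∧ dist (x j) (x i) ≤ 4} : ℝ)))
    (h3 : (∀ (N : ℕ) (x : Fin N → EuclideanSpace ℝ (Fin 3)) (Ω : Finset (Fin N)), (∀ i ∈ Ω, IsTwoShellGood (1 / 20) (47 / 50) 1 x i) → ∀ i ∈ Ω, (∀ k : Fin N, dist (x k) (x i) ≤ 3 → k ∈ Ω) → (∃ (A : EuclideanSpace ℝ (Fin 3) →ₗᵢ[ℝ] EuclideanSpace ℝ (Fin 3)) (a h : ℝ) (s : ℤ → ℤ), 47 / 50 ≤ a ∧ a ≤ 1 ∧ 39 / 50 * a ≤ h ∧ h ≤ 17 / 20 * a ∧ IsHaggSeq s ∧ (fun S : Set (EuclideanSpace ℝ (Fin 3)) => (∀ j : Fin N, dist (x j) (x i) ≤ 2 → ∃ p ∈ S, dist (x j) p ≤ 2 / 5) ∧ (∀ p ∈ S, dist p (x i) ≤ 2 → ∃ j : Fin N, dist (x j) p ≤ 2 / 5)) {p | ∃ m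 u v : ℤ, p = x i + A (((u : ℝ) • triangularVec₁ a) + ((v : ℝ) • triangularVec₂ a) + ((haggLabel s m : ℝ) • barlowOffset a) + ((m : ℝ) • layerNormal h))}))) :
  ∀ η : ℝ, 0 < η → ∃ c : ℝ, 0 < c ∧ ∃ C : ℝ, ∀ (N : ℕ) (x : Fin N → EuclideanSpace ℝ (Fin 3)),
      (∀ i j : Fin N, i ≠ j → 1 / 3 ≤ dist (x i) (x j)) →
      (∀ (i : Fin N) (y : EuclideanSpace ℝ (Fin 3)), (∀ j : Fin N, j ≠ i → y ≠ x j) → siteEnergy lennardJones x i ≤ ∑ j ∈ Finset.univ.erase i, lennardJones (dist y (x j))) →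
      (∀ i : Fin N, ∑ j ∈ Finset.univ.erase i, (deriv lennardJones (dist (x i) (x j)) / dist (x i) (x j)) • (x i - x j) = 0) →
      ∀ Ω : Finset (Fin N), (∀ i ∈ Ω, IsTwoShellGood (1 / 20) (47 / 50) 1 x i) →
      (∀ i ∈ Ω, (∀ k : Fin N, dist (x k) (x i) ≤ 8 → k ∈ Ω) →
        (∃ (A : EuclideanSpace ℝ (Fin 3) →ₗᵢ[ℝ] EuclideanSpace ℝ (Fin 3)) (a h : ℝ) (s : ℤ → ℤ), 47 / 50 ≤ a ∧ a ≤ 1 ∧ 39 / 50 * a ≤ h ∧ h ≤ 17 / 20 * a ∧ IsHaggSeq s ∧ (fun S : Set (EuclideanSpace ℝ (Fin 3)) => (∀ j : Fin N, dist (x j) (x i) ≤ 2 → ∃ p ∈ S, dist (x j) p ≤ 2 / 5) ∧ (∀ p ∈ S, dist p (x i) ≤ 2 → ∃ j : Fin N, dist (x j) p ≤ 2 / 5)) {p | ∃ m u v : ℤ, p = x i + A (((u : ℝ) • triangularVec₁ a) + ((v : ℝ) • triangularVec₂ a) + ((haggLabel s m : ℝ) • barlowOffset a) + ((m : ℝ)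 • layerNormal h))})) →
        c * (Nat.card {i : Fin N // i ∈ Ω ∧ ((∀ k : Fin N, dist (x k) (x i) ≤ 8 → k ∈ Ω) ∧ ¬ (∃ (A : EuclideanSpace ℝ (Fin 3) →ₗᵢ[ℝ] EuclideanSpace ℝ (Fin 3)) (t : EuclideanSpace ℝ (Fin 3)) (a : ℝ) (s : ℤ → ℤ) (z : ℤ → ℝ), 47 / 50 ≤ a ∧ a ≤ 1 ∧ IsHaggSeq s ∧ (∀ m : ℤ, 39 / 50 * a ≤ z (m + 1) - z m ∧ z (m + 1) - z m ≤ 17 / 20 * a) ∧ (fun S : Set (EuclideanSpace ℝ (Fin 3)) => (∀ j : Fin N, dist (x j) (x i) ≤ 2 → ∃ p ∈ S, dist (x j + t) p ≤ η) ∧ (∀ p ∈ S, dist p (x i + t) ≤ 2 → ∃ j : Fin N, dist (x j + t) p ≤ η)) {p | ∃ m i j : ℤ, p = A (((i : ℝ) • triangularVec₁ a) + ((j : ℝ) • triangularVec₂ a) + ((haggLabel s m : ℝ) • barlowOffset a) + (z m • layerNormal 1))}))} : ℝ) ≤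
          (∑ i ∈ Ω, (1 / 2 : ℝ) * (∑ j ∈ Ω.erase i, lennardJones (dist (x i) (x j)))) - (Ω.card : ℝ) * (⨅ Q : PeriodicConfiguration 3, Q.energyPerParticle lennardJones) + C * (Nat.card {i : Fin N // i ∈ Ω ∧ ∃ j : Fin N, j ∉ Ω ∧ dist (x j) (x i) ≤ 4} : ℝ) := by
  intro η hη
  obtain ⟨ε₁, hε₁, hε₁', K, hK, CI, hIall⟩ := hI
  obtain ⟨K2, hK2, CII, hIIall⟩ := hII ε₁ hε₁ hε₁'
  -- the small tolerance and the constants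
  set η' : ℝ := min η (1 / 10) with hη'def
  have hη'pos : 0 < η' := lt_min hη (by norm_num)
  have hη'le : η' ≤ 1 / 10 := min_le_right _ _
  have hη'leη : η' ≤ η := min_le_left _ _
  set K₁ : ℝ := 250 * (1 / 3 : ℝ)⁻¹ ^ 6 / 6 with hK₁
  set K₄ : ℝ := (6 * 4 + 1) ^ 3 with hK₄
  set K₈ : ℝ := (6 * 8 + 1) ^ 3 with hK₈
  set L : ℝ := K * K₁ + |CI| * K₄ + 200 * η' ^ 2 * (1 + K₈) with hLdef
  have hLpos : 0 ≤ L := by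
    have : 0 ≤ K₁ := by rw [hK₁]; positivity
    have : 0 ≤ K₄ := by rw [hK₄]; positivity
    have : 0 ≤ K₈ := by rw [hK₈]; positivity
    rw [hLdef]; positivity
  set D : ℝ := K + L * K2 + 1 with hDdef
  have hDpos : 0 < D := by rw [hDdef]; positivity
  set Mtot : ℝ := L * |CII| + |CI| with hMtot
  refine ⟨200 * η' ^ 2 / D, by positivity, Mtot / D, ?_⟩
  intro N x hsep hNash hFB Ω hΩ _hchart
  classical
  -- II: the non-`ε₁`-good particles of `Ω`
  have hIIapp := hIIall N x hsep hNash hFB Ω hΩ (h3 N x Ω hΩ)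
  -- the rough set and the `ε₁`-good sub-cluster
  set R : Finset (Fin N) := Ω.filter (fun i => ¬ IsTwoShellGood ε₁ (47 / 50) 1 x i) with hRdef
  set Ω' : Finset (Fin N) := Ω.filter (fun i => IsTwoShellGood ε₁ (47 / 50) 1 x i) with hΩ'def
  have hΩ'sub : Ω' ⊆ Ω := Finset.filter_subset _ _
  have hΩ'good : ∀ i ∈ Ω', IsTwoShellGood ε₁ (47 / 50) 1 x i := fun i hi => (Finset.mem_filter.1 hi).2
  -- I on the sub-cluster
  obtain ⟨sW, Gw, νw, rw, Aw, aw, hw, hwit, hsum⟩ := hIall N x hsep hNash hFB Ω' hΩ'good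
  -- counts as filter cardinalities
  simp only [lc_natCard_eq] at hIIapp hsum ⊢
  -- the finite sets of the bookkeeping
  set NL : Finset (Fin N) := Ω.filter (fun i : Fin N => (∀ k : Fin N, dist (x k) (x i) ≤ 8 → k ∈ Ω) ∧ ¬ (∃ (A : EuclideanSpace ℝ (Fin 3) →ₗᵢ[ℝ] EuclideanSpace ℝ (Fin 3)) (t : EuclideanSpace ℝ (Fin 3)) (a : ℝ) (s : ℤ → ℤ) (z : ℤ → ℝ), 47 / 50 ≤ a ∧ a ≤ 1 ∧ IsHaggSeq s ∧ (∀ m : ℤ, 39 / 50 * a ≤ z (m + 1) - z m ∧ z (m + 1) - z m ≤ 17 / 20 * a) ∧ (fun S : Set (EuclideanSpace ℝ (Fin 3)) => (∀ j : Fin N, dist (x j) (x i) ≤ 2 → ∃ p ∈ S, dist (x j + t) p ≤ η) ∧ (∀ p ∈ S, dist p (x i + t) ≤ 2 → ∃ j : Fin N, dist (x j + t) p ≤ η)) {p | ∃ m i j : ℤ, p = A (((i : ℝ) • triangularVec₁ a) + ((j : ℝ) • triangularVec₂ a) + ((haggLabel s m : ℝ) • barlowOffset a) + (z m • layerNormal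 1))})) with hNLdef
  set NL' : Finset (Fin N) := Ω.filter (fun i : Fin N => (∀ k : Fin N, dist (x k) (x i) ≤ 8 → k ∈ Ω) ∧ ¬ (∃ (A : EuclideanSpace ℝ (Fin 3) →ₗᵢ[ℝ] EuclideanSpace ℝ (Fin 3)) (t : EuclideanSpace ℝ (Fin 3)) (a : ℝ) (s : ℤ → ℤ) (z : ℤ → ℝ), 47 / 50 ≤ a ∧ a ≤ 1 ∧ IsHaggSeq s ∧ (∀ m : ℤ, 39 / 50 * a ≤ z (m + 1) - z m ∧ z (m + 1) - z m ≤ 17 / 20 * a) ∧ (fun S : Set (EuclideanSpace ℝ (Fin 3)) => (∀ j : Fin N, dist (x j) (x i) ≤ 2 → ∃ p ∈ S, dist (x j + t) p ≤ η') ∧ (∀ p ∈ S, dist p (x i + t) ≤ 2 → ∃ j : Fin N, dist (x j + t) p ≤ η')) {p | ∃ m i j : ℤ, p = A (((i : ℝ) • triangularVec₁ a) + ((j : ℝ) • triangularVec₂ a) + ((haggLabel s m : ℝ) • barlowOffset a) + (z m • layerNormal 1))})) with hNL'def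
  set I8' : Finset (Fin N) := Ω'.filter (fun i : Fin N => (∀ k : Fin N, dist (x k) (x i) ≤ 8 → k ∈ Ω')) with hI8'def
  set BAD : Finset (Fin N) := I8'.filter (fun i : Fin N => η' / 2 < νw i ∨ η' / 2 < rw i) with hBADdef
  set NR8 : Finset (Fin N) := Ω.filter (fun i : Fin N => ∃ k ∈ R, dist (x i) (x k) ≤ 8) with hNR8def
  set NR4 : Finset (Fin N) := Ω.filter (fun i : Fin N => ∃ k ∈ R, dist (x i) (x k) ≤ 4) with hNR4def
  set B4 : Finset (Fin N) := (Ω.filter fun i : Fin N => ∃ j : Fin N, j ∉ Ω ∧ dist (x j) (x i) ≤ 4) with hB4def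
  set B4' : Finset (Fin N) := (Ω'.filter fun i : Fin N => ∃ j : Fin N, j ∉ Ω' ∧ dist (x j) (x i) ≤ 4) with hB4'def
  -- (F1) monotonicity in the tolerance
  have hF1 : (NL.card : ℝ) ≤ (NL'.card : ℝ) := by
    have hsub : NL ⊆ NL' := by
      intro i hi
      rw [hNLdef, Finset.mem_filter] at hi
      rw [hNL'def, Finset.mem_filter]
      exact ⟨hi.1, hi.2.1, fun h => hi.2.2 (es_layered_mono x i hη'leη h)⟩
    exact_mod_cast Finset.card_le_card hsub
  -- (F2) covering of the non-layered interior sites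
  have hF2 : (NL'.card : ℝ) ≤ (BAD.card : ℝ) + (R.card : ℝ) + (NR8.card : ℝ) := by
    have hsub : NL' ⊆ BAD ∪ R ∪ NR8 := by
      intro i hi
      rw [hNL'def, Finset.mem_filter] at hi
      obtain ⟨hiΩ, h8, hnl⟩ := hi
      rw [Finset.mem_union, Finset.mem_union]
      by_cases hiR : i ∈ R
      · exact Or.inl (Or.inr hiR)
      · have hgi : IsTwoShellGood ε₁ (47 / 50) 1 x i := by
          by_contra hno
          exact hiR (by rw [hRdef, Finset.mem_filter]; exact ⟨hiΩ, hno⟩)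
        have hiΩ' : i ∈ Ω' := by
          rw [hΩ'def, Finset.mem_filter]; exact ⟨hiΩ, hgi⟩
        by_cases h8' : ∀ k : Fin N, dist (x k) (x i) ≤ 8 → k ∈ Ω'
        · -- radius-8 interior site of `Ω'`: bad, by C′ against its own box cell
          have hiI : i ∈ I8' := by rw [hI8'def, Finset.mem_filter]; exact ⟨hiΩ', h8'⟩
          obtain ⟨hs, h0, hflat, ha1, ha2, hh1, hh2, hclose⟩ := hwit i hiΩ' h8'
          refine Or.inl (Or.inl ?_)
          rw [hBADdef, Finset.mem_filter]
          refine ⟨hiI, ?_⟩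
          by_contra hno
          push Not at hno
          obtain ⟨hν, hr⟩ := hno
          have hfar := hC N x i (sW i) (Gw i) (νw i) η' hs h0 (by linarith) hη'le hflat hnl
          obtain ⟨m, u, v, hn, hd⟩ := hfar (Aw i) (aw i) (hw i) ha1 ha2 hh1 hh2
          have hlt := hclose m u v hn
          linarith
        · -- within `8` of a rough site
          push Not at h8'
          obtain ⟨k, hk, hkΩ'⟩ := h8'
          have hkΩ : k ∈ Ω := h8 k hk
          have hkR : k ∈ R := by
            rw [hRdef, Finset.mem_filter]
            refine ⟨hkΩ, ?_⟩
            intro hgk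
            exact hkΩ' (by rw [hΩ'def, Finset.mem_filter]; exact ⟨hkΩ, hgk⟩)
          exact Or.inr (by rw [hNR8def, Finset.mem_filter]; exact ⟨hiΩ, k, hkR, by rw [dist_comm]; exact hk⟩)
    calc (NL'.card : ℝ) ≤ ((BAD ∪ R ∪ NR8).card : ℝ) := by exact_mod_cast Finset.card_le_card hsub
      _ ≤ ((BAD ∪ R).card : ℝ) + (NR8.card : ℝ) := by exact_mod_cast Finset.card_union_le _ _
      _ ≤ (BAD.card : ℝ) + (R.card : ℝ) + (NR8.card : ℝ) := by
          have := Finset.card_union_le BAD R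
          linarith [show ((BAD ∪ R).card : ℝ) ≤ BAD.card + R.card by exact_mod_cast this]
  -- (F3), (F4) neighbourhood counts
  have hF3 : (NR8.card : ℝ) ≤ K₈ * (R.card : ℝ) := by
    have := es_card_filter_near_le x hsep Ω R (by norm_num : (0 : ℝ) ≤ 8)
    rw [hK₈]; norm_num at this ⊢; exact this
  have hF4 : (NR4.card : ℝ) ≤ K₄ * (R.card : ℝ) := by
    have := es_card_filter_near_le x hsep Ω R (by norm_num : (0 : ℝ) ≤ 4)
    rw [hK₄]; norm_num at this ⊢; exact this
  -- (F5) Chebyshev on the bad sites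
  have hF5 : 200 * η' ^ 2 * (BAD.card : ℝ) ≤ ∑ i ∈ I8', (2400 * (νw i) ^ 2 + 800 * (rw i) ^ 2) := by
    have h1 : ∑ i ∈ BAD, (2400 * (νw i) ^ 2 + 800 * (rw i) ^ 2) ≤ ∑ i ∈ I8', (2400 * (νw i) ^ 2 + 800 * (rw i) ^ 2) :=
      Finset.sum_le_sum_of_subset_of_nonneg (Finset.filter_subset _ _) (fun i _ _ => by positivity)
    have h2 : ∑ _i ∈ BAD, 200 * η' ^ 2 ≤ ∑ i ∈ BAD, (2400 * (νw i) ^ 2 + 800 * (rw i) ^ 2) := by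
      refine Finset.sum_le_sum fun i hi => ?_
      rw [hBADdef, Finset.mem_filter] at hi
      rcases hi.2 with hν | hr
      · nlinarith [sq_nonneg (rw i), sq_nonneg (νw i - η' / 2)]
      · nlinarith [sq_nonneg (νw i), sq_nonneg (rw i - η' / 2)]
    rw [Finset.sum_const, nsmul_eq_mul] at h2
    linarith
  -- (F6) the sub-cluster excess
  have hF6 : (∑ i ∈ Ω', (1 / 2 : ℝ) * (∑ j ∈ Ω'.erase i, lennardJones (dist (x i) (x j)))) - (Ω'.card : ℝ) * (⨅ Q : PeriodicConfiguration 3, Q.energyPerParticle lennardJones) ≤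
      (∑ i ∈ Ω, (1 / 2 : ℝ) * (∑ j ∈ Ω.erase i, lennardJones (dist (x i) (x j)))) - (Ω.card : ℝ) * (⨅ Q : PeriodicConfiguration 3, Q.energyPerParticle lennardJones) + K₁ * (R.card : ℝ) := by
    have h := es_subcluster_excess_le x hsep Ω (fun i : Fin N => IsTwoShellGood ε₁ (47 / 50) 1 x i)
    rw [hK₁]
    exact h
  -- (F9) the boundary of the sub-cluster
  have hF9 : (B4'.card : ℝ) ≤ (B4.card : ℝ) + (NR4.card : ℝ) := by
    have hsub : B4' ⊆ B4 ∪ NR4 := by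
      intro i hi
      rw [hB4'def, Finset.mem_filter] at hi
      obtain ⟨hiΩ', j, hjΩ', hd⟩ := hi
      rw [Finset.mem_union]
      by_cases hjΩ : j ∈ Ω
      · refine Or.inr (by
          rw [hNR4def, Finset.mem_filter]
          refine ⟨hΩ'sub hiΩ', j, ?_, by rw [dist_comm]; exact hd⟩
          rw [hRdef, Finset.mem_filter]
          refine ⟨hjΩ, ?_⟩
          intro hgj
          exact hjΩ' (by rw [hΩ'def, Finset.mem_filter]; exact ⟨hjΩ, hgj⟩))
      · exact Or.inl (by rw [hB4def, Finset.mem_filter]; exact ⟨hΩ'sub hiΩ', j, hjΩ, hd⟩)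
    calc (B4'.card : ℝ) ≤ ((B4 ∪ NR4).card : ℝ) := by exact_mod_cast Finset.card_le_card hsub
      _ ≤ (B4.card : ℝ) + (NR4.card : ℝ) := by exact_mod_cast Finset.card_union_le _ _
  -- (F10) the bulk excess is nonnegative
  have hXpos : (0 : ℝ) ≤ (∑ i ∈ Ω, (1 / 2 : ℝ) * (∑ j ∈ Ω.erase i, lennardJones (dist (x i) (x j)))) - (Ω.card : ℝ) * (⨅ Q : PeriodicConfiguration 3, Q.energyPerParticle lennardJones) :=
    pureNearField_self_floor x (by norm_num : (0 : ℝ) < 1 / 3) hsep Ω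
  -- the final linear combination (all products written out as syntactic atoms)
  obtain ⟨X, hXdef⟩ : ∃ X : ℝ, (∑ i ∈ Ω, (1 / 2 : ℝ) * (∑ j ∈ Ω.erase i, lennardJones (dist (x i) (x j)))) - (Ω.card : ℝ) * (⨅ Q : PeriodicConfiguration 3, Q.energyPerParticle lennardJones) = X := ⟨_, rfl⟩
  obtain ⟨XP, hXPdef⟩ : ∃ XP : ℝ, (∑ i ∈ Ω', (1 / 2 : ℝ) * (∑ j ∈ Ω'.erase i, lennardJones (dist (x i) (x j)))) - (Ω'.card : ℝ) * (⨅ Q : PeriodicConfiguration 3, Q.energyPerParticle lennardJones) = XP := ⟨_, rfl⟩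
  obtain ⟨FS, hFSdef⟩ : ∃ FS : ℝ, (∑ i ∈ I8', (2400 * (νw i) ^ 2 + 800 * (rw i) ^ 2)) = FS := ⟨_, rfl⟩
  rw [hXdef] at hIIapp hXpos hF6 ⊢
  rw [hXPdef] at hF6 hsum
  rw [hFSdef] at hsum hF5
  have hB4'pos : (0 : ℝ) ≤ (B4'.card : ℝ) := Nat.cast_nonneg _
  have hB4pos : (0 : ℝ) ≤ (B4.card : ℝ) := Nat.cast_nonneg _
  have hRpos : (0 : ℝ) ≤ (R.card : ℝ) := Nat.cast_nonneg _
  have hNLpos : (0 : ℝ) ≤ (NL.card : ℝ) := Nat.cast_nonneg _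
  -- the rough count, charged to `X + #∂₄Ω`
  have hRle : (R.card : ℝ) ≤ K2 * X + |CII| * (B4.card : ℝ) := by
    have h1 : CII * (B4.card : ℝ) ≤ |CII| * (B4.card : ℝ) := mul_le_mul_of_nonneg_right (le_abs_self CII) hB4pos
    linarith [hIIapp, h1]
  -- the flatness sum, moved back to `Ω`
  have h1 : K * XP ≤ K * X + K * K₁ * (R.card : ℝ) := by
    have h := mul_le_mul_of_nonneg_left hF6 hK
    linear_combination h
  have h2 : CI * (B4'.card : ℝ) ≤ |CI| * (B4.card : ℝ) + |CI| * K₄ * (R.card : ℝ) := by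
    have t1 : CI * (B4'.card : ℝ) ≤ |CI| * (B4'.card : ℝ) := mul_le_mul_of_nonneg_right (le_abs_self CI) hB4'pos
    have hF94 : (B4'.card : ℝ) ≤ (B4.card : ℝ) + K₄ * (R.card : ℝ) := by linarith only [hF9, hF4]
    have t2 := mul_le_mul_of_nonneg_left hF94 (abs_nonneg CI)
    linear_combination t1 + t2
  have h3 : 200 * η' ^ 2 * (BAD.card : ℝ) ≤ K * X + K * K₁ * (R.card : ℝ) + |CI| * (B4.card : ℝ) + |CI| * K₄ * (R.card : ℝ) := by
    linarith only [hF5, hsum, h1, h2]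
  have hη2 : 0 ≤ 200 * η' ^ 2 := by positivity
  have hF123 : (NL.card : ℝ) ≤ (BAD.card : ℝ) + (R.card : ℝ) + K₈ * (R.card : ℝ) := by
    linarith only [hF1, hF2, hF3]
  have h4 : 200 * η' ^ 2 * (NL.card : ℝ) ≤ 200 * η' ^ 2 * (BAD.card : ℝ) + 200 * η' ^ 2 * (1 + K₈) * (R.card : ℝ) := by
    have h := mul_le_mul_of_nonneg_left hF123 hη2
    linear_combination h
  have h5 : 200 * η' ^ 2 * (NL.card : ℝ) ≤ K * X + L * (R.card : ℝ) + |CI| * (B4.card : ℝ) := by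
    rw [hLdef]
    linear_combination h3 + h4
  have h6 : L * (R.card : ℝ) ≤ L * K2 * X + L * |CII| * (B4.card : ℝ) := by
    have h := mul_le_mul_of_nonneg_left hRle hLpos
    linear_combination h
  have final : 200 * η' ^ 2 * (NL.card : ℝ) ≤ D * X + Mtot * (B4.card : ℝ) := by
    rw [hDdef, hMtot]
    linear_combination h5 + h6 + hXpos
  -- divide by `D`
  have hgoal : 200 * η' ^ 2 / D * (NL.card : ℝ) ≤ X + Mtot / D * (B4.card : ℝ) := by
    rw [div_mul_eq_mul_div, div_mul_eq_mul_div, div_le_iff₀ hDpos, add_mul, div_mul_cancel₀ _ hDpos.ne']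
    linarith [final]
  exact hgoal
end Summit.AtomisticToContinuum.Crystallization.Theorems.NashClassCertificatesNashNearField

end
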